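import Mathlib.Data.Fin.VecNotation
import Mathlib.Algebra.Order.Group.Nat
import Mathlib.Data.Fintype.Fin
import Mathlib.Algebra.BigOperators.Fin
import Mathlib.Logic.Function.Basic
import Mathlib.Tactic
import HarnessLib

/-!
# Balancing the three handle counts of a trisection by single-sector stabilisations (arithmetic)

Topic `Literature/Topology/FourManifolds`; the counting step of the proof of Gay–Kirby 2016,
Thm. 4 for the fact seat `provefact-Literature.Topology.FourManifolds.exists_isBalancedGKTrisection`,
isolated as pure arithmetic.  Everything here is **proved**; no definitions, no named facts.

Given any predicate `P g k` on a genus `g : ℕ` and a triple of counts `k : Fin 3 → ℕ` that is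
stable under the **single-sector stabilisation** `(g; k) ↦ (g + 1; k + e_i)` (for trisections:
Gay–Kirby 2016, Def. 8 / Lemma 10 with one implant; Meier–Schirmer–Zupan 2016, the
`i`-stabilisation), every `(g; k₁, k₂, k₃)` can be moved to a **balanced** `(g'; k', k', k')` with
`k' ≤ g'`: first raise the two smaller counts to `K = max kᵢ`, then perform `K` full rounds of three
stabilisations (`(g; K, K, K) ↦ (g + 3; K + 1, K + 1, K + 1)`), after which `k' = 2K ≤ g + 3K = g'`.

* `exists_const_of_stabilize` — raising to the maximum;
* `exists_balanced_of_stabilize` — the balanced form with `k' ≤ g'`.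

## References

* D. Gay, R. Kirby, *Trisecting 4-manifolds*, Geom. Topol. 20 (2016), proof of Thm. 4 ("add cancelling pairs … so as to arrange that `k₁ = k₃`"; Lemma 10). [GayKirby2016]
-/

namespace Literature.Topology.FourManifolds

namespace TrisectionBalancing

variable {P : ℕ → (Fin 3 → ℕ) → Prop}

/-- **Raising all counts to a common bound `K ≥ kᵢ`** by single-sector stabilisations: from
`P g k` one reaches `P (g + n) (K, K, K)` with `n = ∑ (K - kᵢ)`. [folklore] -/
theorem exists_const_of_stabilize (hstab : ∀ g k (i : Fin 3), P g k → P (g + 1) (Function.update k i (k i + 1)))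
    (K : ℕ) : ∀ (n g : ℕ) (k : Fin 3 → ℕ), P g k → (∀ i, k i ≤ K) → (K - k 0) + (K - k 1) + (K - k 2) = n →
      P (g + n) (fun _ => K) := by
  intro n
  induction n with
  | zero =>
    intro g k h hk hn
    have hk0 := hk 0
    have hk1 := hk 1
    have hk2 := hk 2
    have h0 : k 0 = K := by omega
    have h1 : k 1 = K := by omega
    have h2 : k 2 = K := by omega
    have hkK : k = fun _ => K := by
      funext i; fin_cases i <;> assumption
    simpa [hkK] using h
  | succ n ih =>
    intro g k h hk hn
    -- some count is below `K`
    obtain ⟨i, hi⟩ : ∃ i, k i < K := by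
      by_contra hno
      push Not at hno
      have h0 := le_antisymm (hk 0) (hno 0)
      have h1 := le_antisymm (hk 1) (hno 1)
      have h2 := le_antisymm (hk 2) (hno 2)
      omega
    have h' := hstab g k i h
    have hk' : ∀ l, Function.update k i (k i + 1) l ≤ K := by
      intro l
      by_cases hl : l = i
      · subst hl; rw [Function.update_self]; omega
      · rw [Function.update_of_ne hl]; exact hk l
    have hk0 := hk 0
    have hk1 := hk 1
    have hk2 := hk 2
    have hn' : (K - Function.update k i (k i + 1) 0) + (K - Function.update k i (k i + 1) 1) +
        (K - Function.update k i (k i + 1) 2) = n := by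
      obtain rfl | rfl | rfl : i = 0 ∨ i = 1 ∨ i = 2 := by fin_cases i <;> simp
      · rw [Function.update_self, Function.update_of_ne (by decide : (1 : Fin 3) ≠ 0),
          Function.update_of_ne (by decide : (2 : Fin 3) ≠ 0)]
        omega
      · rw [Function.update_self, Function.update_of_ne (by decide : (0 : Fin 3) ≠ 1),
          Function.update_of_ne (by decide : (2 : Fin 3) ≠ 1)]
        omega
      · rw [Function.update_self, Function.update_of_ne (by decide : (0 : Fin 3) ≠ 2),
          Function.update_of_ne (by decide : (1 : Fin 3) ≠ 2)]
        omega
    have := ih (g + 1) _ h' hk' hn'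
    rw [show g + (n + 1) = g + 1 + n by ring]
    exact this

/-- One full round of three stabilisations: `(g; K, K, K) ↦ (g + 3; K + 1, K + 1, K + 1)`. [folklore] -/
theorem round_of_stabilize (hstab : ∀ g k (i : Fin 3), P g k → P (g + 1) (Function.update k i (k i + 1)))
    {g K : ℕ} (h : P g (fun _ => K)) : P (g + 3) (fun _ => K + 1) := by
  have := exists_const_of_stabilize hstab (K + 1) 3 g (fun _ => K) h (fun _ => by simp) (by simp)
  exact this

/-- `t` full rounds: `(g; K, K, K) ↦ (g + 3t; K + t, K + t, K + t)`. [folklore] -/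
theorem rounds_of_stabilize (hstab : ∀ g k (i : Fin 3), P g k → P (g + 1) (Function.update k i (k i + 1)))
    {g K : ℕ} (h : P g (fun _ => K)) (t : ℕ) : P (g + 3 * t) (fun _ => K + t) := by
  induction t with
  | zero => simpa using h
  | succ t ih =>
    have := round_of_stabilize hstab ih
    rw [show g + 3 * (t + 1) = g + 3 * t + 3 by ring, show K + (t + 1) = K + t + 1 by ring]
    exact this

/-- **Balancing**: if `P` is stable under single-sector stabilisations, every `P g k` leads to a
balanced `P g' (k', k', k')` with `k' ≤ g'`. [cite: GayKirby2016, proof of Thm. 4] -/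
theorem exists_balanced_of_stabilize (hstab : ∀ g k (i : Fin 3), P g k → P (g + 1) (Function.update k i (k i + 1)))
    {g : ℕ} {k : Fin 3 → ℕ} (h : P g k) : ∃ g' k' : ℕ, k' ≤ g' ∧ P g' (fun _ => k') := by
  set K := max (k 0) (max (k 1) (k 2)) with hK
  have hk : ∀ i, k i ≤ K := by
    intro i; fin_cases i <;> simp [hK]
  have h1 := exists_const_of_stabilize hstab K _ g k h hk rfl
  have h2 := rounds_of_stabilize hstab h1 K
  exact ⟨_, _, by omega, h2⟩

end TrisectionBalancing

end Literature.Topology.FourManifolds
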